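import Summits.RiemannHypothesis.RiemannHypothesis.Theorems.WeilTwoPrimeDeflE25EDef
import Summits.RiemannHypothesis.RiemannHypothesis.Theorems.WeilTwoPrimeDeflE25EDataPE33
import Literature.NumberTheory.LFunctions.WeilBlockRowsR
import HarnessLib

/-!
# Even-sector deflated two-prime certificate E25E: the materialized even block agrees with `P_r + Σ μ ĉ ĉᵀ`, rows 90–99

`WeilCert.checkPmRowG` for certificate E25E (even block), by `decide +kernel`. Pure proof file; nothing is asserted.
-/

set_option linter.dupNamespace false

noncomputable section

namespace Summit.RiemannHypothesis.RiemannHypothesis.Theorems.EvenWinsBeyondArch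

open Literature.NumberTheory.LFunctions

set_option maxHeartbeats 0 in
/-- Row 90 of the materialized even block is row 90 of `P_r + Σ μ ĉ ĉᵀ` (certificate E25E). [folklore] -/
theorem checkPmRowG0_90_weilCertDeflE25E : weilCertDeflE25EBase.checkPmRowG weilCertDeflE25EP weilCertDeflE25EPmE 0 90 = true := by
  decide +kernel

set_option maxHeartbeats 0 in
/-- Row 91 of the materialized even block is row 91 of `P_r + Σ μ ĉ ĉᵀ` (certificate E25E). [folklore] -/
theorem checkPmRowG0_91_weilCertDeflE25E : weilCertDeflE25EBase.checkPmRowG weilCertDeflE25EP weilCertDeflE25EPmE 0 91 = true := by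
  decide +kernel

set_option maxHeartbeats 0 in
/-- Row 92 of the materialized even block is row 92 of `P_r + Σ μ ĉ ĉᵀ` (certificate E25E). [folklore] -/
theorem checkPmRowG0_92_weilCertDeflE25E : weilCertDeflE25EBase.checkPmRowG weilCertDeflE25EP weilCertDeflE25EPmE 0 92 = true := by
  decide +kernel

set_option maxHeartbeats 0 in
/-- Row 93 of the materialized even block is row 93 of `P_r + Σ μ ĉ ĉᵀ` (certificate E25E). [folklore] -/
theorem checkPmRowG0_93_weilCertDeflE25E : weilCertDeflE25EBase.checkPmRowG weilCertDeflE25EP weilCertDeflE25EPmE 0 93 = true := by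
  decide +kernel

set_option maxHeartbeats 0 in
/-- Row 94 of the materialized even block is row 94 of `P_r + Σ μ ĉ ĉᵀ` (certificate E25E). [folklore] -/
theorem checkPmRowG0_94_weilCertDeflE25E : weilCertDeflE25EBase.checkPmRowG weilCertDeflE25EP weilCertDeflE25EPmE 0 94 = true := by
  decide +kernel

set_option maxHeartbeats 0 in
/-- Row 95 of the materialized even block is row 95 of `P_r + Σ μ ĉ ĉᵀ` (certificate E25E). [folklore] -/
theorem checkPmRowG0_95_weilCertDeflE25E : weilCertDeflE25EBase.checkPmRowG weilCertDeflE25EP weilCertDeflE25EPmE 0 95 = true := by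
  decide +kernel

set_option maxHeartbeats 0 in
/-- Row 96 of the materialized even block is row 96 of `P_r + Σ μ ĉ ĉᵀ` (certificate E25E). [folklore] -/
theorem checkPmRowG0_96_weilCertDeflE25E : weilCertDeflE25EBase.checkPmRowG weilCertDeflE25EP weilCertDeflE25EPmE 0 96 = true := by
  decide +kernel

set_option maxHeartbeats 0 in
/-- Row 97 of the materialized even block is row 97 of `P_r + Σ μ ĉ ĉᵀ` (certificate E25E). [folklore] -/
theorem checkPmRowG0_97_weilCertDeflE25E : weilCertDeflE25EBase.checkPmRowG weilCertDeflE25EP weilCertDeflE25EPmE 0 97 = true := by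
  decide +kernel

set_option maxHeartbeats 0 in
/-- Row 98 of the materialized even block is row 98 of `P_r + Σ μ ĉ ĉᵀ` (certificate E25E). [folklore] -/
theorem checkPmRowG0_98_weilCertDeflE25E : weilCertDeflE25EBase.checkPmRowG weilCertDeflE25EP weilCertDeflE25EPmE 0 98 = true := by
  decide +kernel

set_option maxHeartbeats 0 in
/-- Row 99 of the materialized even block is row 99 of `P_r + Σ μ ĉ ĉᵀ` (certificate E25E). [folklore] -/
theorem checkPmRowG0_99_weilCertDeflE25E : weilCertDeflE25EBase.checkPmRowG weilCertDeflE25EP weilCertDeflE25EPmE 0 99 = true := by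
  decide +kernel


end Summit.RiemannHypothesis.RiemannHypothesis.Theorems.EvenWinsBeyondArch
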